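import Literature.MathematicalPhysics.QuantumFieldTheory.Balaban1983to89.B8Eq348CubeMemberTowerGramAlgebra

/-!
# `Balaban1983to89.B8Eq348CubeMemberTowerGramCoercive` — [Balaban1985BackgroundPropagators] (3.48): the `ℓ²` GAP of the tower Gram matrix `QT⁻²Qᵀ` of the cube member
# from a norm bound on `T` — `Σ_p L^{−(d+1)j_p}X_p² ≤ C_T²·⟨X, (QT⁻¹T⁻¹Qᵀ)X⟩` (second brick of the 𝒢-bound programme)

statement-level skeleton of published theorems with citation tags; proofs where landed; nothing here is a claim about the
Yang–Mills mass gap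

`[Balaban1985BackgroundPropagators]` ("[4]") Theorem 3.2 (3.48) p. 398, (3.25) p. 394 (`R = I − G′Q′*(Q′G′²Q′*)⁻¹Q′G′`, the operator `Q′G′²Q′*`);
`[Balaban1985RegularSpaces]` (1.91) p. 91; `[Balaban1984PropagatorsII]` Prop. 2.3 (2.87) p. 238.

CITATION HEADER (lean-in-tree rule).  Cell `pub-ymgap` (YM Track A, HUMAN RULING D-0062), DAG node N05 = [B8], seat `pub-ymgap-dag-n05-c` (g9; (R1′) programme, file F11).
The 𝒢-bound programme (`B8Thm32GBoundCubeMember.GBoundCubeMemberPrinted`, design `HOME/pub-ymgap-dag-n05-c/R23-DESIGN.md` §UPDATE) inverts `M = QT⁻²Qᵀ` by a tower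
parametrix whose shallow piece (towers of level `≤ 1`) is controlled by Combes–Thomas on the block-tridiagonal `M`; its input is an `ℓ²` GAP for `M`.  THIS FILE types
the gap's algebraic half, in the consumer's verbatim shapes: `⟨X, MX⟩ = ‖T⁻¹QᵀX‖²` (`T⁻¹` symmetric, n05-e), `QᵀX = T·(T⁻¹QᵀX)`, `‖QᵀX‖² = Σ_p L^{−(d+1)j_p}X_p²` (F9
`towerGram_QQt`) — so any bound `‖Tv‖² ≤ C_T²‖v‖²` yields `Σ_p L^{−(d+1)j_p}X_p² ≤ C_T²⟨X, MX⟩`.  The norm bound itself (`C_T² = η⁻⁴(36(d+1)² + 2a_max²)` from the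
row structure of `K`) is the next brick.

WHAT THIS FILE PROVES (kernel-checked; one theorem; any `L ≥ 1`, any nonnegative weights, cube datum with `L ≤ ρ`, truncation `n ≤ k`).
* ★ `towerGram_coercive_of_normBound` — `(∀ v, Σ_x (Tv)_x² ≤ C_T² Σ_x v_x²) ⟹ Σ_p L^{−(d+1)j_p}X_p² ≤ C_T²·(X ⬝ᵥ (QT⁻¹T⁻¹Qᵀ)X)` for every `X` on the towers.

HONEST SCOPE ∕ NOT CLAIMED.  Linear algebra only; the norm bound on `T` is a hypothesis; the 𝒢-bound stays OPEN.  Count-neutral; N05 NOT discharged; one finite `T⁴`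
programme at fixed `ε`, Bałaban as printed; nothing continuum ∕ ℝ⁴ ∕ OS ∕ mass-gap ∕ Clay.  No `sorry`, no `def`, no `instance`, no `notation`.  Unit `pub-ymgap-dag-n05-c` (g9), 2026-08-27.

RELATED IN THE TREE, NOT DUPLICATED: `B8Eq348CubeMemberTowerGramAlgebra.towerGram_QQt` (F9, USED), `B8Eq191FlatTowerGram.flatMatrix_inv_transpose` ∕ `isUnit_towerGram`
(n05-e, USED ∕ sibling: invertibility without a quantitative gap), `B8Eq191FlatDirichletForm.isUnit_flatMatrix` (USED), `B8Eq191FlatDirichletCoercive.weighted_coercive_flatMatrix`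
(g8: the LOWER bound on `⟨v, Tv⟩` — the opposite direction, not used here).
-/
noncomputable section

namespace Literature.MathematicalPhysics.QuantumFieldTheory.Balaban1983to89.B8Eq348CubeMemberTowerGramCoercive

open scoped Matrix
open B7Prop1Explicit (e)
open B8Eq131CubesAdmissible (cubeFam)
open B8CubeMemberZd (cubeLamS)
open B8Eq191FlatDirichletForm (isUnit_flatMatrix)
open B8Eq191FlatTowerGram (flatMatrix_inv_transpose)
open B8Eq348CubeMemberTowerGramAlgebra (towerGram_QQt)
open Literature.MathematicalPhysics.QuantumLattice (blockMap)

variable {d : ℕ}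

/-! ## §1 The tower Gram form `⟨X, QT⁻²QᵀX⟩ = ‖T⁻¹QᵀX‖²` dominates `‖QᵀX‖² = Σ_p L^{−(d+1)j_p}X_p²` up to `‖T‖²` -/

open Classical in
/-- **COERCIVITY OF THE TOWER GRAM MATRIX FROM A NORM BOUND ON `T`.**  For the consumer's `T = (K(x,z))` (any nonnegative weights) and `Q` on the cube member:
`⟨X, (QT⁻¹T⁻¹Qᵀ)X⟩ = ‖T⁻¹QᵀX‖²` (`T⁻¹` is symmetric), `QᵀX = T·(T⁻¹QᵀX)`, so a bound `‖Tv‖² ≤ C_T²‖v‖²` gives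
`Σ_p L^{−(d+1)j_p}X_p² = ‖QᵀX‖² ≤ C_T²·⟨X, (QT⁻¹T⁻¹Qᵀ)X⟩` (`QQᵀ = diag(L^{−(d+1)j_p})`, F9).  The `ℓ²` gap used for the wall towers in the 𝒢-bound programme.
[cite: Balaban1985BackgroundPropagators, (3.48) p.398, (3.25) p.394; Balaban1985RegularSpaces, (1.91) p.91; Balaban1984PropagatorsII, (2.87) p.238] -/
theorem towerGram_coercive_of_normBound (hd : 0 < d + 1) {L : ℕ} (hL : 1 ≤ L) (a : Fin (d + 1) → ℤ) (M : ℕ) {ρ : ℕ} (hρ : L ≤ ρ) {k n : ℕ} (hn : n ≤ k)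
    {η : ℝ} (hη : η ≠ 0) (w : ℕ → ℝ) (hw0 : ∀ j, 0 ≤ w j)
    (S : Finset (Fin (d + 1) → ℤ)) (hS : ∀ x, x ∈ S ↔ x ∈ cubeFam false L a M ρ k 0)
    (B : Finset (ℕ × (Fin (d + 1) → ℤ))) (hB : ∀ p, p ∈ B ↔ p.1 ≤ n ∧ p.2 ∈ cubeLamS L a M ρ k n p.1)
    (K : (Fin (d + 1) → ℤ) → (Fin (d + 1) → ℤ) → ℝ)
    (hK : ∀ x z, K x z = ((η ^ 2)⁻¹ * ∑ μ : Fin (d + 1), ((2 : ℝ) * (if z = x then (1 : ℝ) else 0) - (if z = x + e μ then (1 : ℝ) else 0)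
        - (if z = x - e μ then (1 : ℝ) else 0))) +
        (∑ j ∈ Finset.range (n + 1), (if blockMap (L ^ j) x ∈ cubeLamS L a M ρ k n j ∧ blockMap (L ^ j) z = blockMap (L ^ j) x then
          w j * ((((L : ℝ) ^ (d + 1))⁻¹) ^ j) ^ 2 else 0)))
    (T : Matrix ↥S ↥S ℝ) (hT : T = Matrix.of (fun x z : ↥S => K x.1 z.1))
    (Q : Matrix ↥B ↥S ℝ) (hQ : Q = Matrix.of (fun (p : ↥B) (z : ↥S) =>
      if blockMap (L ^ p.1.1) z.1 = p.1.2 then (((L : ℝ) ^ (d + 1))⁻¹) ^ p.1.1 else 0))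
    {CT : ℝ} (hTn : ∀ v : ↥S → ℝ, ∑ x, ((T *ᵥ v) x) ^ 2 ≤ CT ^ 2 * ∑ x, (v x) ^ 2) (X : ↥B → ℝ) :
    ∑ p : ↥B, (((L : ℝ) ^ (d + 1))⁻¹) ^ p.1.1 * (X p) ^ 2 ≤ CT ^ 2 * (X ⬝ᵥ ((Q * T⁻¹ * T⁻¹ * Qᵀ) *ᵥ X)) := by
  -- the units and the symmetry of `T⁻¹`
  have hTunit : IsUnit T := by rw [hT]; exact isUnit_flatMatrix hd hη L n (cubeLamS L a M ρ k n) w hw0 K hK S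
  have hTT : T * T⁻¹ = 1 := Matrix.mul_nonsing_inv T ((Matrix.isUnit_iff_isUnit_det T).mp hTunit)
  have hsymm : (T⁻¹)ᵀ = T⁻¹ := by rw [hT]; exact flatMatrix_inv_transpose L n (cubeLamS L a M ρ k n) w K hK S
  -- `⟨X, NᵀN X⟩ = ‖NX‖²`
  have key : ∀ N : Matrix ↥S ↥B ℝ, X ⬝ᵥ ((Nᵀ * N) *ᵥ X) = (N *ᵥ X) ⬝ᵥ (N *ᵥ X) := fun N => by
    rw [← Matrix.mulVec_mulVec, Matrix.dotProduct_mulVec, Matrix.vecMul_transpose]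
  -- `QT⁻¹T⁻¹Qᵀ = (T⁻¹Qᵀ)ᵀ(T⁻¹Qᵀ)` and `QQᵀ = (Qᵀ)ᵀQᵀ`
  have hM : Q * T⁻¹ * T⁻¹ * Qᵀ = (T⁻¹ * Qᵀ)ᵀ * (T⁻¹ * Qᵀ) := by
    rw [Matrix.transpose_mul, Matrix.transpose_transpose, hsymm]
    simp only [Matrix.mul_assoc]
  have hQQ : Q * Qᵀ = (Qᵀ)ᵀ * Qᵀ := by rw [Matrix.transpose_transpose]
  -- the letter `Z = T⁻¹QᵀX`, with `QᵀX = T·Z`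
  obtain ⟨Z, hZ⟩ : ∃ Z : ↥S → ℝ, Z = (T⁻¹ * Qᵀ) *ᵥ X := ⟨_, rfl⟩
  have hTZ : T *ᵥ Z = Qᵀ *ᵥ X := by rw [hZ, Matrix.mulVec_mulVec, ← Matrix.mul_assoc, hTT, Matrix.one_mul]
  -- `Σ_p L^{−(d+1)j_p}X_p² = ‖QᵀX‖²`
  have hYY : ∑ p : ↥B, (((L : ℝ) ^ (d + 1))⁻¹) ^ p.1.1 * (X p) ^ 2 = (Qᵀ *ᵥ X) ⬝ᵥ (Qᵀ *ᵥ X) := by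
    rw [← key Qᵀ, ← hQQ, towerGram_QQt hL a M hρ hn S hS B hB Q hQ, dotProduct]
    refine Finset.sum_congr rfl fun p _ => ?_
    rw [Matrix.mulVec_diagonal]; ring
  have hsq1 : (Qᵀ *ᵥ X) ⬝ᵥ (Qᵀ *ᵥ X) = ∑ x, ((T *ᵥ Z) x) ^ 2 := by
    rw [← hTZ, dotProduct]; exact Finset.sum_congr rfl fun x _ => by ring
  have hsq2 : X ⬝ᵥ ((Q * T⁻¹ * T⁻¹ * Qᵀ) *ᵥ X) = ∑ x, (Z x) ^ 2 := by
    rw [hM, key, ← hZ, dotProduct]; exact Finset.sum_congr rfl fun x _ => by ring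
  rw [hYY, hsq1, hsq2]
  exact hTn Z

end Literature.MathematicalPhysics.QuantumFieldTheory.Balaban1983to89.B8Eq348CubeMemberTowerGramCoercive
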